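import Mathlib
import HarnessLib
import Literature.Analysis.FluidPDE.TaoAveragedNondegeneracy
import Summits.NavierStokesRegularity.NavierStokesRegularity.Theorems.UnthreadedDoorNetFluxDefs
import Summits.NavierStokesRegularity.NavierStokesRegularity.Theorems.UnthreadedDoorNetFluxEnvelopeDefs
import Summits.NavierStokesRegularity.NavierStokesRegularity.Theorems.UnthreadedDoorNetFluxEnvelopeToolkit
import Summits.NavierStokesRegularity.NavierStokesRegularity.Theorems.UnthreadedDoorNetFluxEnvelopeRegularity
import Summits.NavierStokesRegularity.NavierStokesRegularity.Theorems.UnthreadedDoorNetFluxLevelLipschitz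

/-!
# Route `UnthreadedDoor`, crux `PoloidalLiouville` (stmt-NavierStokesRegularity-1222), WALL W1 — netflux line,
# NF-1a: THE EXTREMAL HEAD DIFFERENCE ON ONE TIME SLICE — choice-independence, EMF bound, Lipschitz in `r`

Part of the proof of the research stub NF-1a `stub_extremalHeadEMF` (`NetFlux.ExtremalHeadEMF`, Theorems twin in
`UnthreadedDoorNetFluxEnvelopeDefs`) of the registered line `Cruxes/PoloidalLiouville/Lines/netflux_typei_gap.lean`
(planner ns-idea-14).  Fixed-time data («slice data»): `v : ℝ³ → ℝ³` smooth with `‖v‖ ≤ V`, `T` smooth and `P ∈ C¹` off `x₀`,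
the TANGENTIAL head relation `∇P − m∇T ∥ (x − x₀)` with `m = ⟪v, x − x₀⟫`, every sphere `S_r(x₀)` saddle-free.

* `abs_head_sub_le` — (Λ) on each sphere: `|P x − P y| ≤ V r |T x − T y|` for `x, y ∈ S_r(x₀)` (`levelLipschitz` with
  `μ = m`, `|m| ≤ V r`);
* `head_diff_indep` — (i) `P x⁺ − P x⁻` does not depend on the choice of `x⁺ ∈ argmax_{S_r} T`, `x⁻ ∈ argmin`;
* `abs_head_diff_le_netFlux` — (iv) the EMF bound `|P x⁺ − P x⁻| ≤ V · netFlux T x₀ r`;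
* `exists_lipschitz_sphSup_sphInf` — `r ↦ max_{S_r} T`, `min_{S_r} T` are Lipschitz on `[a,b] ⊂ (0,∞)` (radial mean value);
* `lipschitzOnWith_head_diff` — (iii) for ANY selections `x⁺(r) ∈ argmax`, `x⁻(r) ∈ argmin`, the extremal head difference
  `r ↦ P(x⁺(r)) − P(x⁻(r))` is Lipschitz on `[a,b] ⊂ (0,∞)`: compare `S_r` and `S_{r'}` along radially scaled points, the end
  corrections being `≤ V r' |max_{S_{r'}} T − T(x̃⁺)|` by (Λ).

WHAT THIS IS NOT: no NS statement; `PoloidalLiouville` (1222), W1, the line's rung and NF-1a itself stay OPEN here.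
`--supports stmt-NavierStokesRegularity-1222 --as helper`.  [folklore]
-/

noncomputable section

-- the summit and its single sub-problem share the name (CONVENTIONS §1)
set_option linter.dupNamespace false

open Set Function Filter Topology InnerProductSpace MeasureTheory Metric
open scoped RealInnerProductSpace ContDiff

namespace Summit.NavierStokesRegularity.NavierStokesRegularity.Theorems.PoloidalLiouville.NetFlux

open Literature.Analysis Literature.Analysis.FluidPDE

/-! ### Radial mean value and the Lipschitz property of the spherical extrema -/

/-- A bound for `‖Df‖` on the shell `a ≤ ‖y − x₀‖ ≤ b` (`0 < a`) for `f ∈ C¹(ℝ³ ∖ {x₀})`. [folklore] -/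
theorem exists_bound_fderiv_shell {f : E3 → ℝ} {x₀ : E3} (hf : ContDiffOn ℝ 1 f ({x₀}ᶜ : Set E3)) {a b : ℝ}
    (ha : 0 < a) : ∃ K : ℝ, 0 ≤ K ∧ ∀ y : E3, ‖y - x₀‖ ∈ Icc a b → ‖fderiv ℝ f y‖ ≤ K := by
  have hsub : {y : E3 | ‖y - x₀‖ ∈ Icc a b} ⊆ ({x₀}ᶜ : Set E3) := by
    intro y hy h0
    rw [mem_singleton_iff] at h0
    rw [mem_setOf_eq, h0, sub_self, norm_zero] at hy
    linarith [hy.1]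
  have hc : ContinuousOn (fun y => ‖fderiv ℝ f y‖) {y : E3 | ‖y - x₀‖ ∈ Icc a b} :=
    ((hf.continuousOn_fderiv_of_isOpen isOpen_compl_singleton le_rfl).mono hsub).norm
  obtain ⟨K, hK⟩ := (isCompact_shell x₀ a b).exists_bound_of_continuousOn hc
  refine ⟨max K 0, le_max_right _ _, fun y hy => ?_⟩
  have h := hK y hy
  rw [Real.norm_eq_abs, abs_of_nonneg (norm_nonneg _)] at h
  exact h.trans (le_max_left _ _)

/-- **Radial mean value inequality**: `|f(x₀ + ρ ξ) − f(x₀ + ρ' ξ)| ≤ K |ρ − ρ'|` for `‖ξ‖ = 1`, `ρ, ρ' ∈ [a,b] ⊂ (0,∞)`,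
`K` a bound of `‖Df‖` on the shell. [folklore] -/
theorem abs_sub_radial_le {f : E3 → ℝ} {x₀ : E3} (hf : ContDiffOn ℝ 1 f ({x₀}ᶜ : Set E3)) {a b K : ℝ}
    (ha : 0 < a) (hK : ∀ y : E3, ‖y - x₀‖ ∈ Icc a b → ‖fderiv ℝ f y‖ ≤ K) {ξ : E3} (hξ : ‖ξ‖ = 1)
    {ρ ρ' : ℝ} (hρ : ρ ∈ Icc a b) (hρ' : ρ' ∈ Icc a b) :
    |f (x₀ + ρ • ξ) - f (x₀ + ρ' • ξ)| ≤ K * |ρ - ρ'| := by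
  have hmem : ∀ σ ∈ Icc a b, ‖x₀ + σ • ξ - x₀‖ ∈ Icc a b := by
    intro σ hσ
    rw [add_sub_cancel_left, norm_smul, hξ, mul_one, Real.norm_eq_abs, abs_of_pos (ha.trans_le hσ.1)]
    exact hσ
  have hne : ∀ σ ∈ Icc a b, x₀ + σ • ξ ≠ x₀ := by
    intro σ hσ h0
    have := hmem σ hσ
    rw [h0, sub_self, norm_zero] at this
    linarith [this.1]
  have hd : ∀ σ ∈ Icc a b, HasDerivWithinAt (fun σ : ℝ => f (x₀ + σ • ξ)) (fderiv ℝ f (x₀ + σ • ξ) ξ) (Icc a b) σ := by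
    intro σ hσ
    have hfd : DifferentiableAt ℝ f (x₀ + σ • ξ) :=
      (hf.differentiableOn one_ne_zero _ (hne σ hσ)).differentiableAt (isOpen_compl_singleton.mem_nhds (hne σ hσ))
    exact (hasDerivAt_radial hfd).hasDerivWithinAt
  have hbd : ∀ σ ∈ Icc a b, ‖fderiv ℝ f (x₀ + σ • ξ) ξ‖ ≤ K := by
    intro σ hσ
    calc ‖fderiv ℝ f (x₀ + σ • ξ) ξ‖ ≤ ‖fderiv ℝ f (x₀ + σ • ξ)‖ * ‖ξ‖ := ContinuousLinearMap.le_opNorm _ _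
      _ ≤ K * 1 := by rw [hξ]; exact mul_le_mul_of_nonneg_right (hK _ (hmem σ hσ)) zero_le_one
      _ = K := mul_one K
  have h := Convex.norm_image_sub_le_of_norm_hasDerivWithin_le hd hbd (convex_Icc a b) hρ' hρ
  rw [Real.norm_eq_abs, Real.norm_eq_abs] at h
  exact h

/-- **The spherical extrema are Lipschitz in the radius**: for `T ∈ C¹(ℝ³ ∖ {x₀})` and `0 < a ≤ b` there is `K ≥ 0` with
`|max_{S_r} T − max_{S_{r'}} T| ≤ K |r − r'|` and the same for `min`, for `r, r' ∈ [a,b]`. [folklore] -/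
theorem exists_lipschitz_sphSup_sphInf {T : E3 → ℝ} {x₀ : E3} (hT : ContDiffOn ℝ 1 T ({x₀}ᶜ : Set E3)) {a b : ℝ}
    (ha : 0 < a) : ∃ K : ℝ, 0 ≤ K ∧ ∀ r ∈ Icc a b, ∀ r' ∈ Icc a b,
      |sphSup T x₀ r - sphSup T x₀ r'| ≤ K * |r - r'| ∧ |sphInf T x₀ r - sphInf T x₀ r'| ≤ K * |r - r'| := by
  obtain ⟨K, hK0, hK⟩ := exists_bound_fderiv_shell hT ha (b := b)
  refine ⟨K, hK0, fun r hr r' hr' => ?_⟩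
  have hr0 : 0 < r := ha.trans_le hr.1
  have hr0' : 0 < r' := ha.trans_le hr'.1
  have hTc : ContinuousOn T ({x₀}ᶜ : Set E3) := hT.continuousOn
  have hcr : ContinuousOn T (Metric.sphere x₀ r) := continuousOn_sphere_of_continuousOn_compl hTc hr0
  have hcr' : ContinuousOn T (Metric.sphere x₀ r') := continuousOn_sphere_of_continuousOn_compl hTc hr0'
  -- pointwise radial comparison
  have hrad : ∀ ξ : E3, ‖ξ‖ = 1 → |T (x₀ + r • ξ) - T (x₀ + r' • ξ)| ≤ K * |r - r'| :=
    fun ξ hξ => abs_sub_radial_le hT ha hK hξ hr hr'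
  have hmemS : ∀ {ρ : ℝ}, 0 < ρ → ∀ ξ : E3, ‖ξ‖ = 1 → x₀ + ρ • ξ ∈ Metric.sphere x₀ ρ := by
    intro ρ hρ ξ hξ
    rw [mem_sphere_iff_norm, add_sub_cancel_left, norm_smul, hξ, mul_one, Real.norm_eq_abs, abs_of_pos hρ]
  -- every point of `S_ρ` is `x₀ + ρ ξ`
  have hpolar : ∀ {ρ : ℝ}, 0 < ρ → ∀ x ∈ Metric.sphere x₀ ρ, ∃ ξ : E3, ‖ξ‖ = 1 ∧ x = x₀ + ρ • ξ := by
    intro ρ hρ x hx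
    refine ⟨ρ⁻¹ • (x - x₀), ?_, ?_⟩
    · rw [norm_smul, norm_inv, Real.norm_eq_abs, abs_of_pos hρ, mem_sphere_iff_norm.1 hx, inv_mul_cancel₀ hρ.ne']
    · rw [smul_smul, mul_inv_cancel₀ hρ.ne', one_smul, add_sub_cancel]
  -- sup comparison, both directions
  have hsup : ∀ {ρ ρ' : ℝ}, 0 < ρ → 0 < ρ' → ContinuousOn T (Metric.sphere x₀ ρ) → ContinuousOn T (Metric.sphere x₀ ρ') →
      (∀ ξ : E3, ‖ξ‖ = 1 → |T (x₀ + ρ • ξ) - T (x₀ + ρ' • ξ)| ≤ K * |r - r'|) →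
      sphSup T x₀ ρ ≤ sphSup T x₀ ρ' + K * |r - r'| := by
    intro ρ ρ' hρ hρ' hc hc' hb
    obtain ⟨x, hx, hxe⟩ := exists_eq_sphSup hc hρ.le
    obtain ⟨ξ, hξ, rfl⟩ := hpolar hρ x hx
    rw [← hxe]
    have h1 := hb ξ hξ
    have h2 := le_sphSup hc' (hmemS hρ' ξ hξ)
    rw [abs_le] at h1
    linarith [h1.2]
  have hinf : ∀ {ρ ρ' : ℝ}, 0 < ρ → 0 < ρ' → ContinuousOn T (Metric.sphere x₀ ρ) → ContinuousOn T (Metric.sphere x₀ ρ') →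
      (∀ ξ : E3, ‖ξ‖ = 1 → |T (x₀ + ρ • ξ) - T (x₀ + ρ' • ξ)| ≤ K * |r - r'|) →
      sphInf T x₀ ρ' ≤ sphInf T x₀ ρ + K * |r - r'| := by
    intro ρ ρ' hρ hρ' hc hc' hb
    -- a minimiser on `S_ρ`
    obtain ⟨x, hx, hmin⟩ := (isCompact_sphere x₀ ρ).exists_isMinOn (NormedSpace.sphere_nonempty.2 hρ.le) hc
    have hxe : sphInf T x₀ ρ = T x := by
      refine le_antisymm (csInf_le ((isCompact_sphere x₀ ρ).bddBelow_image hc) ⟨x, hx, rfl⟩) ?_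
      exact le_csInf ⟨T x, x, hx, rfl⟩ (by rintro _ ⟨y, hy, rfl⟩; exact hmin hy)
    obtain ⟨ξ, hξ, rfl⟩ := hpolar hρ x hx
    rw [hxe]
    have h1 := hb ξ hξ
    have h2 : sphInf T x₀ ρ' ≤ T (x₀ + ρ' • ξ) :=
      csInf_le ((isCompact_sphere x₀ ρ').bddBelow_image hc') ⟨_, hmemS hρ' ξ hξ, rfl⟩
    rw [abs_le] at h1
    linarith [h1.1]
  have hrad' : ∀ ξ : E3, ‖ξ‖ = 1 → |T (x₀ + r' • ξ) - T (x₀ + r • ξ)| ≤ K * |r - r'| := fun ξ hξ => by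
    rw [abs_sub_comm]; exact hrad ξ hξ
  constructor
  · rw [abs_le]
    constructor
    · linarith [hsup hr0' hr0 hcr' hcr hrad']
    · linarith [hsup hr0 hr0' hcr hcr' hrad]
  · rw [abs_le]
    constructor
    · linarith [hinf hr0 hr0' hcr hcr' hrad]
    · linarith [hinf hr0' hr0 hcr' hcr hrad']

/-! ### The slice data of NF-1a and (Λ) on each sphere -/

section Slice

variable {v : E3 → E3} {T P : E3 → ℝ} {x₀ : E3} {V : ℝ}

/-- **(Λ) for the head on one sphere**: `|P x − P y| ≤ V·r·|T x − T y|` on `S_r(x₀)` for the slice data of NF-1a.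
[folklore] -/
theorem abs_head_sub_le (hv : ContDiff ℝ (⊤ : ℕ∞) v) (hT : ContDiffOn ℝ (⊤ : ℕ∞) T ({x₀}ᶜ : Set E3))
    (hP : ContDiffOn ℝ 1 P ({x₀}ᶜ : Set E3)) (hV : ∀ x, ‖v x‖ ≤ V)
    (hpar : ∀ x, x ≠ x₀ → cross (gradient P x - (⟪v x, x - x₀⟫) • gradient T x) (x - x₀) = 0)
    (hU : ∀ r > 0, IsUnimodalSphere T x₀ r) {r : ℝ} (hr : 0 < r)
    {x y : E3} (hx : x ∈ Metric.sphere x₀ r) (hy : y ∈ Metric.sphere x₀ r) :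
    |P x - P y| ≤ V * r * |T x - T y| := by
  have hμ : ContDiffOn ℝ (⊤ : ℕ∞) (fun x => ⟪v x, x - x₀⟫) ({x₀}ᶜ : Set E3) :=
    (hv.contDiffOn.inner ℝ (contDiffOn_id.sub contDiffOn_const))
  have hL : ∀ z ∈ Metric.sphere x₀ r, |⟪v z, z - x₀⟫| ≤ V * r := by
    intro z hz
    calc |⟪v z, z - x₀⟫| ≤ ‖v z‖ * ‖z - x₀‖ := abs_real_inner_le_norm _ _
      _ ≤ V * r := by
        rw [mem_sphere_iff_norm.1 hz]
        exact mul_le_mul_of_nonneg_right (hV z) hr.le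
  exact levelLipschitz T P (fun x => ⟪v x, x - x₀⟫) x₀ r (V * r) hr hT hP hμ
    (fun z hz => hpar z (ne_center_of_mem_sphere hr hz)) hL (hU r hr) x hx y hy

/-- **(i) Choice-independence of the extremal head difference.** [folklore] -/
theorem head_diff_indep (hv : ContDiff ℝ (⊤ : ℕ∞) v) (hT : ContDiffOn ℝ (⊤ : ℕ∞) T ({x₀}ᶜ : Set E3))
    (hP : ContDiffOn ℝ 1 P ({x₀}ᶜ : Set E3)) (hV : ∀ x, ‖v x‖ ≤ V)
    (hpar : ∀ x, x ≠ x₀ → cross (gradient P x - (⟪v x, x - x₀⟫) • gradient T x) (x - x₀) = 0)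
    (hU : ∀ r > 0, IsUnimodalSphere T x₀ r) {r : ℝ} (hr : 0 < r)
    {xp xp' xm xm' : E3} (hxp : xp ∈ sphArgmax T x₀ r) (hxp' : xp' ∈ sphArgmax T x₀ r)
    (hxm : xm ∈ sphArgmin T x₀ r) (hxm' : xm' ∈ sphArgmin T x₀ r) :
    P xp - P xm = P xp' - P xm' := by
  have hPeq : ∀ x ∈ Metric.sphere x₀ r, ∀ y ∈ Metric.sphere x₀ r, T x = T y → P x = P y := by
    intro x hx y hy hxy
    have h := abs_head_sub_le hv hT hP hV hpar hU hr hx hy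
    rw [hxy, sub_self, abs_zero, mul_zero] at h
    exact eq_of_abs_sub_nonpos h
  have hTp : T xp = T xp' := le_antisymm (hxp'.2 xp hxp.1) (hxp.2 xp' hxp'.1)
  have hTm : T xm = T xm' := le_antisymm (hxm.2 xm' hxm'.1) (hxm'.2 xm hxm.1)
  rw [hPeq xp hxp.1 xp' hxp'.1 hTp, hPeq xm hxm.1 xm' hxm'.1 hTm]

/-- **(iv) The EMF bound** `|P x⁺ − P x⁻| ≤ V · netFlux T x₀ r = V · r · (max − min)`. [folklore] -/
theorem abs_head_diff_le_netFlux (hv : ContDiff ℝ (⊤ : ℕ∞) v) (hT : ContDiffOn ℝ (⊤ : ℕ∞) T ({x₀}ᶜ : Set E3))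
    (hP : ContDiffOn ℝ 1 P ({x₀}ᶜ : Set E3)) (hV : ∀ x, ‖v x‖ ≤ V)
    (hpar : ∀ x, x ≠ x₀ → cross (gradient P x - (⟪v x, x - x₀⟫) • gradient T x) (x - x₀) = 0)
    (hU : ∀ r > 0, IsUnimodalSphere T x₀ r) {r : ℝ} (hr : 0 < r)
    {xp xm : E3} (hxp : xp ∈ sphArgmax T x₀ r) (hxm : xm ∈ sphArgmin T x₀ r) :
    |P xp - P xm| ≤ V * netFlux T x₀ r := by
  have hcont : ContinuousOn T (Metric.sphere x₀ r) := continuousOn_sphere_of_continuousOn_compl hT.continuousOn hr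
  have hsup : sphSup T x₀ r = T xp := sphSup_eq_of_mem_sphArgmax hcont hxp
  have hinf : sphInf T x₀ r = T xm := by
    refine IsLeast.csInf_eq ⟨⟨xm, hxm.1, rfl⟩, ?_⟩
    rintro _ ⟨y, hy, rfl⟩
    exact hxm.2 y hy
  have hge : T xm ≤ T xp := hxp.2 xm hxm.1
  have h := abs_head_sub_le hv hT hP hV hpar hU hr hxp.1 hxm.1
  have hnf : netFlux T x₀ r = r * (T xp - T xm) := by simp only [netFlux, sphOsc, hsup, hinf]
  rw [hnf, abs_of_nonneg (sub_nonneg.mpr hge)] at *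
  calc |P xp - P xm| ≤ V * r * (T xp - T xm) := h
    _ = V * (r * (T xp - T xm)) := by ring

/-- **(iii) The extremal head difference is Lipschitz in `r` on `[a,b] ⊂ (0,∞)`**, for any selections of extremisers.
[folklore] -/
theorem lipschitzOnWith_head_diff (hv : ContDiff ℝ (⊤ : ℕ∞) v) (hT : ContDiffOn ℝ (⊤ : ℕ∞) T ({x₀}ᶜ : Set E3))
    (hP : ContDiffOn ℝ 1 P ({x₀}ᶜ : Set E3)) (hV : ∀ x, ‖v x‖ ≤ V)
    (hpar : ∀ x, x ≠ x₀ → cross (gradient P x - (⟪v x, x - x₀⟫) • gradient T x) (x - x₀) = 0)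
    (hU : ∀ r > 0, IsUnimodalSphere T x₀ r) {a b : ℝ} (ha : 0 < a)
    {xp xm : ℝ → E3} (hxp : ∀ r ∈ Icc a b, xp r ∈ sphArgmax T x₀ r) (hxm : ∀ r ∈ Icc a b, xm r ∈ sphArgmin T x₀ r) :
    ∃ K : NNReal, LipschitzOnWith K (fun r => P (xp r) - P (xm r)) (Icc a b) := by
  have hT1 : ContDiffOn ℝ 1 T ({x₀}ᶜ : Set E3) := hT.of_le (by exact_mod_cast le_top)
  obtain ⟨KT, hKT0, hKT⟩ := exists_bound_fderiv_shell hT1 ha (b := b)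
  obtain ⟨KP, hKP0, hKP⟩ := exists_bound_fderiv_shell hP ha (b := b)
  obtain ⟨KS, hKS0, hKS⟩ := exists_lipschitz_sphSup_sphInf hT1 ha (b := b)
  have hV0 : 0 ≤ V := (norm_nonneg _).trans (hV x₀)
  -- unit directions and scaled points
  have hunit : ∀ {ρ : ℝ}, 0 < ρ → ∀ x ∈ Metric.sphere x₀ ρ, ‖ρ⁻¹ • (x - x₀)‖ = 1 ∧ x = x₀ + ρ • (ρ⁻¹ • (x - x₀)) := by
    intro ρ hρ x hx
    refine ⟨?_, ?_⟩
    · rw [norm_smul, norm_inv, Real.norm_eq_abs, abs_of_pos hρ, mem_sphere_iff_norm.1 hx, inv_mul_cancel₀ hρ.ne']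
    · rw [smul_smul, mul_inv_cancel₀ hρ.ne', one_smul, add_sub_cancel]
  have hmemS : ∀ {ρ : ℝ}, 0 < ρ → ∀ ξ : E3, ‖ξ‖ = 1 → x₀ + ρ • ξ ∈ Metric.sphere x₀ ρ := by
    intro ρ hρ ξ hξ
    rw [mem_sphere_iff_norm, add_sub_cancel_left, norm_smul, hξ, mul_one, Real.norm_eq_abs, abs_of_pos hρ]
  have hTc : ∀ {ρ : ℝ}, 0 < ρ → ContinuousOn T (Metric.sphere x₀ ρ) := fun hρ =>
    continuousOn_sphere_of_continuousOn_compl hT.continuousOn hρ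
  -- the one-sided estimate for a maximiser / minimiser moved from `S_r` to `S_{r'}`
  have hend : ∀ r ∈ Icc a b, ∀ r' ∈ Icc a b, ∀ x x' : E3, x ∈ Metric.sphere x₀ r → x' ∈ Metric.sphere x₀ r' →
      ((T x = sphSup T x₀ r ∧ T x' = sphSup T x₀ r') ∨ (T x = sphInf T x₀ r ∧ T x' = sphInf T x₀ r')) →
      |P x' - P x| ≤ (V * b * (KS + KT) + KP) * |r - r'| := by
    intro r hr r' hr' x x' hx hx' hext
    have hr0 : 0 < r := ha.trans_le hr.1
    have hr0' : 0 < r' := ha.trans_le hr'.1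
    obtain ⟨hξ, hxe⟩ := hunit hr0 x hx
    set ξ := r⁻¹ • (x - x₀) with hξdef
    have hxt : x₀ + r' • ξ ∈ Metric.sphere x₀ r' := hmemS hr0' ξ hξ
    -- (Λ) on `S_{r'}`
    have h1 : |P x' - P (x₀ + r' • ξ)| ≤ V * r' * |T x' - T (x₀ + r' • ξ)| :=
      abs_head_sub_le hv hT hP hV hpar hU hr0' hx' hxt
    -- the values of `T`
    have h2 : |T x' - T (x₀ + r' • ξ)| ≤ (KS + KT) * |r - r'| := by
      have hTrad : |T (x₀ + r • ξ) - T (x₀ + r' • ξ)| ≤ KT * |r - r'| := abs_sub_radial_le hT1 ha hKT hξ hr hr'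
      rw [← hxe] at hTrad
      have hS := hKS r hr r' hr'
      rcases hext with ⟨hxv, hx'v⟩ | ⟨hxv, hx'v⟩
      · have h3 : |T x' - T x| ≤ KS * |r - r'| := by rw [hx'v, hxv, abs_sub_comm]; exact hS.1
        calc |T x' - T (x₀ + r' • ξ)| = |(T x' - T x) + (T x - T (x₀ + r' • ξ))| := by ring_nf
          _ ≤ |T x' - T x| + |T x - T (x₀ + r' • ξ)| := abs_add_le _ _
          _ ≤ KS * |r - r'| + KT * |r - r'| := add_le_add h3 hTrad
          _ = (KS + KT) * |r - r'| := by ring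
      · have h3 : |T x' - T x| ≤ KS * |r - r'| := by rw [hx'v, hxv, abs_sub_comm]; exact hS.2
        calc |T x' - T (x₀ + r' • ξ)| = |(T x' - T x) + (T x - T (x₀ + r' • ξ))| := by ring_nf
          _ ≤ |T x' - T x| + |T x - T (x₀ + r' • ξ)| := abs_add_le _ _
          _ ≤ KS * |r - r'| + KT * |r - r'| := add_le_add h3 hTrad
          _ = (KS + KT) * |r - r'| := by ring
    -- the radial displacement of `P`
    have h3 : |P (x₀ + r' • ξ) - P x| ≤ KP * |r - r'| := by
      have := abs_sub_radial_le hP ha hKP hξ hr' hr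
      rw [← hxe, abs_sub_comm r' r] at this
      exact this
    have hVr : V * r' ≤ V * b := mul_le_mul_of_nonneg_left hr'.2 hV0
    have habs : 0 ≤ |r - r'| := abs_nonneg _
    calc |P x' - P x| = |(P x' - P (x₀ + r' • ξ)) + (P (x₀ + r' • ξ) - P x)| := by ring_nf
      _ ≤ |P x' - P (x₀ + r' • ξ)| + |P (x₀ + r' • ξ) - P x| := abs_add_le _ _
      _ ≤ V * r' * ((KS + KT) * |r - r'|) + KP * |r - r'| :=
          add_le_add (h1.trans (mul_le_mul_of_nonneg_left h2 (mul_nonneg hV0 hr0'.le))) h3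
      _ ≤ V * b * ((KS + KT) * |r - r'|) + KP * |r - r'| := by
          have : 0 ≤ (KS + KT) * |r - r'| := mul_nonneg (add_nonneg hKS0 hKT0) habs
          nlinarith [hVr]
      _ = (V * b * (KS + KT) + KP) * |r - r'| := by ring
  -- assemble
  set K : ℝ := 2 * (V * b * (KS + KT) + KP) with hK
  refine ⟨K.toNNReal, LipschitzOnWith.of_dist_le_mul fun r hr r' hr' => ?_⟩
  have hr0 : 0 < r := ha.trans_le hr.1
  have hr0' : 0 < r' := ha.trans_le hr'.1
  have hsupv : ∀ {ρ : ℝ} (hρ : ρ ∈ Icc a b), T (xp ρ) = sphSup T x₀ ρ := fun {ρ} hρ =>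
    (sphSup_eq_of_mem_sphArgmax (hTc (ha.trans_le hρ.1)) (hxp ρ hρ)).symm
  have hinfv : ∀ {ρ : ℝ} (hρ : ρ ∈ Icc a b), T (xm ρ) = sphInf T x₀ ρ := by
    intro ρ hρ
    symm
    refine IsLeast.csInf_eq ⟨⟨xm ρ, (hxm ρ hρ).1, rfl⟩, ?_⟩
    rintro _ ⟨y, hy, rfl⟩
    exact (hxm ρ hρ).2 y hy
  have hp := hend r hr r' hr' (xp r) (xp r') (hxp r hr).1 (hxp r' hr').1 (Or.inl ⟨hsupv hr, hsupv hr'⟩)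
  have hm := hend r hr r' hr' (xm r) (xm r') (hxm r hr).1 (hxm r' hr').1 (Or.inr ⟨hinfv hr, hinfv hr'⟩)
  rw [Real.dist_eq, Real.dist_eq]
  have hKle : K ≤ (K.toNNReal : ℝ) := Real.le_coe_toNNReal K
  calc |P (xp r) - P (xm r) - (P (xp r') - P (xm r'))| = |(P (xm r') - P (xm r)) - (P (xp r') - P (xp r))| := by
        ring_nf
    _ ≤ |P (xm r') - P (xm r)| + |P (xp r') - P (xp r)| := abs_sub _ _
    _ ≤ (V * b * (KS + KT) + KP) * |r - r'| + (V * b * (KS + KT) + KP) * |r - r'| := add_le_add hm hp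
    _ = K * |r - r'| := by rw [hK]; ring
    _ ≤ (K.toNNReal : ℝ) * |r - r'| := mul_le_mul_of_nonneg_right hKle (abs_nonneg _)

end Slice

end Summit.NavierStokesRegularity.NavierStokesRegularity.Theorems.PoloidalLiouville.NetFlux

end
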